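import Mathlib
import HarnessLib
import Summits.Ventures.LatticeQCDFlow.Scaling.AR1SwitchingProcess

/-!
# AR1SwitchingJarzynski — with Gaussian innovations the work of the AR(1) switching process is
# Gaussian, Jarzynski's identity `E e^{−W} = 1` holds, and the population ESS is `exp(−Var W)` —
# the last dictionary step of the `k′` law, derived from the dynamics

HONEST FRAMING: exact (Metropolis-corrected) sampling algorithms for lattice gauge theory;
figures of merit are autocorrelation/cost numbers at stated couplings and volumes; no
continuum-physics claim.

Venture `LatticeQCDFlow` (cell pub-lqcd), topic `Scaling`; FANOUT row 19 (`su2-snf`, GEN-4).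
OUR WORK over Mathlib's Gaussian API (`HasGaussianLaw`, `gaussianReal`, `mgf_gaussianReal`) and
`Scaling/AR1SwitchingProcess` (`ar1State`, `ar1Work`, `IsStdInnovations`,
`variance_ar1Work_eq_two_mul_integral`); nothing is cited as a fact.  This closes the chain
dynamics → moments → Gaussian law → exactness → ESS inside the tree: `AR1SwitchingLaw` had to
quote `ESS = e^{−Var W}` from the dictionary `Scaling/GaussianWorkDictionary`; here it is a theorem
about the process.

## Content (all proved; `innovVec ξ n ω = (ξ_0 ω, …, ξ_{n−1} ω) ∈ ℝ^n`)

* `ar1State_affine`, `ar1Work_affine` — every state `y_k` (`k < n`) and the work `W` of the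
  `n`-step protocol are AFFINE functions `c + L(innovVec)` of the first `n` innovations
  (`L` a continuous linear form; by induction along the autoregression);
* **`hasGaussianLaw_ar1Work`** — if the first `n` innovations are JOINTLY GAUSSIAN
  (`HasGaussianLaw (innovVec ξ n) P`; e.g. independent standard normals, by Mathlib's
  `iIndepFun.hasGaussianLaw`), the work is Gaussian; `mgf_ar1Work` —
  `E e^{tW} = exp(t E W + t² Var W/2)`;
* **`integral_exp_neg_ar1Work`** — with, in addition, wide-sense standardised innovations and
  `ρ² + τ² = 1` (so that `Var W = 2 E W`, `AR1SwitchingProcess`): **`E e^{−W} = 1`** — JARZYNSKI'S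
  IDENTITY for the translated trap (`ΔF = 0`), i.e. the model IS an exact non-equilibrium
  sampler, recovered from its Gaussian dynamics rather than assumed;
* **`essPop_ar1Work`** — **`(E e^{−W})²/E e^{−2W} = exp(−Var W)`**: the population Kish ESS of
  the model, whence (with `AR1SwitchingBridge` + `AR1SwitchingLaw`) for the uniformly dragged trap
  and `n_dof` independent coordinates `−log ESS = n_dof·Var W₁ = k′ n_dof/n − (correction)`,
  `k′ = Δ²(1+ρ)/(1−ρ)`.

NOT CLAIMED: anything beyond the model; finite-sample (`ÊSS`) statistics (see
`Exactness/SampleESS`, `Scoring/KishESS*`).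
-/

namespace Summit.Ventures.LatticeQCDFlow.Scaling

open MeasureTheory ProbabilityTheory Finset

variable {Ω : Type*} {mΩ : MeasurableSpace Ω} {P : Measure Ω}

/-- The vector of the first `n` innovations, `ω ↦ (ξ_0 ω, …, ξ_{n−1} ω) ∈ ℝ^n`. -/
def innovVec (ξ : ℕ → Ω → ℝ) (n : ℕ) : Ω → (Fin n → ℝ) := fun ω i => ξ i ω

/-- Every state `y_k`, `k < n`, is an AFFINE function of the first `n` innovations:
`y_k = c + L(ξ_0, …, ξ_{n−1})` for a constant `c` and a continuous linear form `L`. -/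
theorem ar1State_affine (m : ℕ → ℝ) (ρ τ : ℝ) (ξ : ℕ → Ω → ℝ) (n : ℕ) :
    ∀ k, k < n → ∃ c : ℝ, ∃ L : (Fin n → ℝ) →L[ℝ] ℝ,
      ∀ ω, ar1State m ρ τ ξ k ω = c + L (innovVec ξ n ω)
  | 0, h => ⟨m 0, ContinuousLinearMap.proj (⟨0, h⟩ : Fin n), fun ω => by
      simp [ar1State, innovVec]⟩
  | k + 1, h => by
      obtain ⟨c, L, hcL⟩ := ar1State_affine m ρ τ ξ n k (Nat.lt_of_succ_lt h)
      refine ⟨(1 - ρ) * m (k + 1) + ρ * c, ρ • L + τ • ContinuousLinearMap.proj (⟨k + 1, h⟩ : Fin n),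
        fun ω => ?_⟩
      simp only [ar1State, hcL ω, innovVec, add_apply, FunLike.coe_smul, Pi.smul_apply,
        ContinuousLinearMap.proj_apply, smul_eq_mul]
      ring

/-- The work of the `n`-step protocol is an AFFINE function of the first `n` innovations. -/
theorem ar1Work_affine (m : ℕ → ℝ) (ρ τ : ℝ) (ξ : ℕ → Ω → ℝ) (n : ℕ) :
    ∃ c : ℝ, ∃ L : (Fin n → ℝ) →L[ℝ] ℝ, ∀ ω, ar1Work m ρ τ ξ n ω = c + L (innovVec ξ n ω) := by
  -- partial sums `Σ_{k<j}`, `j ≤ n`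
  have key : ∀ j, j ≤ n → ∃ c : ℝ, ∃ L : (Fin n → ℝ) →L[ℝ] ℝ, ∀ ω,
      ∑ k ∈ range j, ((ar1State m ρ τ ξ k ω - m (k + 1)) ^ 2 / 2
        - (ar1State m ρ τ ξ k ω - m k) ^ 2 / 2) = c + L (innovVec ξ n ω) := by
    intro j
    induction j with
    | zero => intro _; exact ⟨0, 0, fun ω => by simp⟩
    | succ j ih =>
        intro hj
        obtain ⟨c, L, hcL⟩ := ih (Nat.le_of_succ_le hj)
        obtain ⟨c', L', hcL'⟩ := ar1State_affine m ρ τ ξ n j (Nat.lt_of_succ_le hj)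
        refine ⟨c + ((m (j + 1) - m j) * (m j + m (j + 1)) / 2 - (m (j + 1) - m j) * c'),
          L - (m (j + 1) - m j) • L', fun ω => ?_⟩
        rw [sum_range_succ, hcL ω, hcL' ω]
        simp only [sub_apply, FunLike.coe_smul, Pi.smul_apply, smul_eq_mul]
        ring
  obtain ⟨c, L, hcL⟩ := key n le_rfl
  exact ⟨c, L, fun ω => hcL ω⟩

section Gaussian

variable {ξ : ℕ → Ω → ℝ} {n : ℕ} (hG : HasGaussianLaw (innovVec ξ n) P) (m : ℕ → ℝ) (ρ τ : ℝ)
include hG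

/-- **The work is Gaussian** when the first `n` innovations are jointly Gaussian (e.g. independent
standard normals, `iIndepFun.hasGaussianLaw`): an affine image of a Gaussian vector. -/
theorem hasGaussianLaw_ar1Work : HasGaussianLaw (ar1Work m ρ τ ξ n) P := by
  obtain ⟨c, L, hcL⟩ := ar1Work_affine m ρ τ ξ n
  have hLV : HasGaussianLaw (fun ω => L (innovVec ξ n ω)) P := hG.map_fun L
  have hlaw : HasLaw (fun ω => L (innovVec ξ n ω))
      (gaussianReal P[fun ω => L (innovVec ξ n ω)] (Var[fun ω => L (innovVec ξ n ω); P]).toNNReal) P :=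
    ⟨hLV.aemeasurable, hLV.map_eq_gaussianReal⟩
  have hW : ar1Work m ρ τ ξ n = fun ω => c + L (innovVec ξ n ω) := funext hcL
  rw [hW]
  exact (gaussianReal_const_add hlaw c).hasGaussianLaw

/-- The exponential moments of the Gaussian work: `E e^{tW} = exp(t·E W + t²·Var W/2)`. -/
theorem mgf_ar1Work (t : ℝ) :
    mgf (ar1Work m ρ τ ξ n) P t
      = Real.exp (P[ar1Work m ρ τ ξ n] * t + Var[ar1Work m ρ τ ξ n; P] * t ^ 2 / 2) := by
  have h := mgf_gaussianReal (hasGaussianLaw_ar1Work hG m ρ τ).map_eq_gaussianReal t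
  rw [h, Real.coe_toNNReal _ (variance_nonneg _ _)]

variable (h : IsStdInnovations P ξ) (hρτ : ρ ^ 2 + τ ^ 2 = 1)
include h hρτ

/-- **JARZYNSKI'S IDENTITY FOR THE MODEL, from the dynamics**: `E e^{−W} = 1 = e^{−ΔF}` (the trap
is translated, `ΔF = 0`) — Gaussian work with `Var W = 2 E W`
(`variance_ar1Work_eq_two_mul_integral`). -/
theorem integral_exp_neg_ar1Work : ∫ ω, Real.exp (-ar1Work m ρ τ ξ n ω) ∂P = 1 := by
  have := hG.isProbabilityMeasure
  have hm := mgf_ar1Work hG m ρ τ (-1)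
  have hv := variance_ar1Work_eq_two_mul_integral h m ρ τ hρτ n
  simp only [mgf, neg_one_mul] at hm
  rw [hm, hv]
  conv_rhs => rw [← Real.exp_zero]
  congr 1
  ring

/-- **THE ESS OF THE MODEL, from the dynamics**: the population Kish effective sample size
`(E e^{−W})²/E e^{−2W}` equals `exp(−Var W)` — the dictionary `ESS = e^{−s}` of
`Scaling/GaussianWorkDictionary` DERIVED for the process; with `AR1SwitchingBridge` /
`AR1SwitchingLaw`, `−log ESS = Var W = k′/n − (correction)` per degree of freedom for the uniform
protocol. -/
theorem essPop_ar1Work :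
    (∫ ω, Real.exp (-ar1Work m ρ τ ξ n ω) ∂P) ^ 2 / (∫ ω, Real.exp (-2 * ar1Work m ρ τ ξ n ω) ∂P)
      = Real.exp (-Var[ar1Work m ρ τ ξ n; P]) := by
  have := hG.isProbabilityMeasure
  rw [integral_exp_neg_ar1Work hG m ρ τ h hρτ]
  have hm := mgf_ar1Work hG m ρ τ (-2)
  have hv := variance_ar1Work_eq_two_mul_integral h m ρ τ hρτ n
  simp only [mgf] at hm
  rw [hm, one_pow, one_div, ← Real.exp_neg]
  congr 1
  nlinarith [hv]

end Gaussian

end Summit.Ventures.LatticeQCDFlow.Scaling
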